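import Summits.CriticalPhenomena.PercolationContinuityZ3.Theorems.Transplant.FKConnectivityAllQCondClusterDomOneLeTools
import Summits.CriticalPhenomena.PercolationContinuityZ3.Theorems.PercNearOneGluingAdditiveGluingBystanderCluster
import HarnessLib

/-!
# Connectivity correlation inequalities for `φ_{w,q}` — the two CONDITIONAL monotonicity nodes MMc⁺ / MMc⁻ hold for every `q ≥ 1`

Support file (`--supports stmt-CriticalPhenomena-4575`), FK sub-lane `prim-bschramm-fk-1` (gen 9) of the post-continuity
programme; builds on p205010 (kernel theorem, internal audit signed; external expert review pending).  No definitions of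
statements, no named facts, no sorries; standard axioms.

THEOREMS (`condClusterDomAdjOn_of_one_le`, `crossClusterAntiAdjOn_of_one_le`): for every finite vertex type `V` and every
`q ≥ 1` the conjecture nodes MMc⁺ (`FK.CondClusterDomAdjOn V q`: given `{x ↮ c}` the law of `C_x` is stochastically increasing in
the state of a pair `f = xz` at `x`) and MMc⁻ (`FK.CrossClusterAntiAdjOn V q`: given `{x ↮ c}` the law of `C_c` is stochastically
decreasing in the state of `f`) of fk-1 g8 (`…CondClusterDomDefs.lean`) HOLD.  With g8's `hubCondUnder_of_condClusterDomAdjOn` /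
`twoArmNegUnder_of_cond` this re-derives vdBHK's Theorems 1.3/1.4-shape statements for `φ_{w,q}`, `q ≥ 1`, through the two
single-edge monotonicity statements (regression `example`s at the end).

PROOF (one measure).  Put `φ := φ_{w[f↦0],q}`, `r := q⁻¹ ∈ (0,1]`, `D := {x ↮ z}`.  Opening `f` costs the factor `r^{1_D}`
(`rcWeightW_update_one_insert`, fk-2 g6), so `φ_{w[f↦1]}(E) = κ·E_φ[(1_{Dᶜ} + r·1_D)·1_E(ω ∪ {f})]` for one constant `κ > 0`
(`real_update_one_eq`), and `C_x(ω ∪ {f}) = C_x(ω) ∪ C_z(ω)`, `{x ↮ c}(ω ∪ {f}) = {x ↮ c} ∩ {z ↮ c}`, while off `C_x ∪ C_z`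
nothing changes.  Both node inequalities thereby become AFFINE in `r`, and it suffices to check the endpoints `r = 1` and `r = 0`:
* MMc⁺, `r = 0`: `Cov(1{C_x ∈ 𝒰}, 1{z ∈ C_x} | x ↮ c) ≥ 0` — one-cluster conditional positive association (vdBHK Thm 1.3 for
  `φ_{𝐩,q}`, `q ≥ 1`, tree theorem `BHK2006_clusterConditionalPositiveAssociation_rc`);
* MMc⁺, `r = 1`: `φ(C_x ∪ C_z ∈ 𝒰, x ↮ c, z ↮ c)·φ(x ↮ c) ≥ φ(C_x ∈ 𝒰, x ↮ c)·φ(x ↮ c, z ↮ c)`: drop `C_z`, then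
  `Cov(1{C_x ∈ 𝒰}, h(C_x) | x ↮ c) ≥ 0` with `h(S) = φ_{G − S̄}(z ↮ c)` (domain Markov, vdBHK Lemma 2.3/2.4 for `φ_{𝐩,q}`:
  `rc_set_sum_cond_cluster`) increasing in `S` (comparison in `𝐩`, Grimmett Thm (3.21)) — CPA again;
* MMc⁻, `r = 1`: `Cov(1{C_c ∈ 𝒱}, 1{z ∈ C_c} | x ↮ c) ≥ 0` — CPA for `C_c`;
* MMc⁻, `r = 0`: `Cov(1{C_c ∈ 𝒱}, g(C_c) | x ↮ c) ≤ 0` with `g(S) = 1{z ∉ S}·φ_{G − S̄}(x ↔ z)` decreasing — CPA (Markov again).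
For `q < 1` (`r > 1`) the affine reduction gives nothing; the nodes stay conjectural there (census fk-1 g8: 0 violations).
[cite: VandenbergHaggstromKahn2005, Thms. 1.3, 1.4 (pp. 6–7); Thm. 2.1 (p. 9); Lemma 2.3/2.4 (p. 10)]
[cite: Grimmett2006, Thm. (3.1)(a) (p. 37); Thm. (3.21) (p. 43); §1.4 eq. (1.20) (p. 15)]
-/

noncomputable section

namespace Summit.CriticalPhenomena.PercolationContinuityZ3.Theorems

namespace FK

open MeasureTheory Set Literature.Probability.LatticeModels Literature.Probability.Percolation
open Literature.Probability.Percolation.KNPreFKG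
open scoped Classical symmDiff
open BHK2006 DecisionTree HullPort
open Literature.Probability.Percolation.TwoAvoidanceSets (ind_mul_ind)

variable {V : Type*} [Fintype V]

/-! ### MMc⁺ for every `q ≥ 1` -/

omit [Fintype V] in
/-- `1_{x↮c}(ω ∪ {xz}) = 1_{x↮c, z↮c}(ω)`. [folklore] -/
theorem ind_sepEv_insert (x z c : V) (ω : BondConfig V) :
    ind (sepEv x c) (insert s(x, z) ω) = ind (sepEv x c ∩ sepEv z c) ω :=
  BystanderBHK.ind_congr (by rw [insert_mem_sepEv_self_iff]; rfl)

omit [Fintype V] in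
/-- `1_{C_x ∈ 𝒰, x↮c}(ω ∪ {xz}) = 1_{C_x ∪ C_z ∈ 𝒰, x↮c, z↮c}(ω)`. [folklore] -/
theorem ind_clusterIn_sepEv_insert (x z c : V) (𝒰 : Set (Set V)) (ω : BondConfig V) :
    ind (clusterIn x 𝒰 ∩ sepEv x c) (insert s(x, z) ω) =
      ind ({ω : BondConfig V | openCluster ω x ∪ openCluster ω z ∈ 𝒰} ∩ (sepEv x c ∩ sepEv z c)) ω := by
  refine BystanderBHK.ind_congr ?_
  rw [mem_inter_iff, mem_inter_iff, insert_mem_sepEv_self_iff]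
  refine and_congr ?_ Iff.rfl
  change openCluster (insert s(x, z) ω) x ∈ 𝒰 ↔ openCluster ω x ∪ openCluster ω z ∈ 𝒰
  rw [openCluster_insert_self]

omit [Fintype V] in
/-- On `{x ↔ z}` the glued cluster is the cluster: `{C_x ∪ C_z ∈ 𝒰} ∩ {x↮c, z↮c} ∩ {x↔z} = {C_x ∈ 𝒰} ∩ {x↮c} ∩ {x↔z}`. [folklore] -/
theorem glued_inter_openConn_eq (x z c : V) (𝒰 : Set (Set V)) :
    {ω : BondConfig V | openCluster ω x ∪ openCluster ω z ∈ 𝒰} ∩ (sepEv x c ∩ sepEv z c) ∩ openConn x z =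
      clusterIn x 𝒰 ∩ sepEv x c ∩ openConn x z := by
  ext ω
  simp only [mem_inter_iff, mem_setOf_eq, mem_sepEv_iff]
  constructor
  · rintro ⟨⟨hU, hxc, -⟩, hxz⟩
    have hxz' : (openGraph ω).Reachable x z := hxz
    refine ⟨⟨?_, hxc⟩, hxz⟩
    change openCluster ω x ∈ 𝒰
    rwa [KNPreFKG.openCluster_eq_of_reachable hxz'.symm, union_self] at hU
  · rintro ⟨⟨hU, hxc⟩, hxz⟩
    have hxz' : (openGraph ω).Reachable x z := hxz
    refine ⟨⟨?_, hxc, fun hzc => hxc (hxz'.trans hzc)⟩, hxz⟩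
    change openCluster ω x ∈ 𝒰 at hU
    rwa [KNPreFKG.openCluster_eq_of_reachable hxz'.symm, union_self]

omit [Fintype V] in
/-- On `{x ↔ z}`, `{x↮c, z↮c} ∩ {x↔z} = {x↮c} ∩ {x↔z}`. [folklore] -/
theorem sepEv_inter_sepEv_inter_openConn_eq (x z c : V) :
    (sepEv x c ∩ sepEv z c) ∩ openConn x z = (sepEv x c ∩ openConn x z : Set (BondConfig V)) := by
  ext ω
  simp only [mem_inter_iff, mem_sepEv_iff]
  constructor
  · rintro ⟨⟨hxc, -⟩, hxz⟩; exact ⟨hxc, hxz⟩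
  · rintro ⟨hxc, hxz⟩
    have hxz' : (openGraph ω).Reachable x z := hxz
    exact ⟨⟨hxc, fun hzc => hxc (hxz'.trans hzc)⟩, hxz⟩

/-- The `φ_{w[f↦1]}`-side integrand split along `{x↔z}`/`{x↮z}`:
`E[(1_{x↔z} + r·1_{x↮z})·1_S] = E[1_{S ∩ {x↔z}}] + r·E[1_{S ∩ {x↮z}}]`. [folklore] -/
theorem rcE_toggle_ind (w : Sym2 V → unitInterval) (q : ℝ) (x z : V) (S : Set (BondConfig V)) :
    rcE w q (fun ω => (ind (openConn x z : Set (BondConfig V)) ω + q⁻¹ * ind (openConn x z : Set (BondConfig V))ᶜ ω) * ind S ω) =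
      rcE w q (ind (S ∩ openConn x z)) + q⁻¹ * rcE w q (ind (S ∩ sepEv x z)) := by
  rw [← rcE_const_mul_fun, ← rcE_add_fun]
  refine congrArg (rcE w q) (funext fun ω => ?_)
  rw [ind_inter, ind_inter, ← sepEv_eq_compl_openConn]
  ring

/-- **MMc⁺ holds for every `q ≥ 1`**: given `{x ↮ c}`, the law of `C_x` under `φ_{w,q}` is stochastically increasing in the state of a
pair `xz` at `x`.  Proof: contraction identity + affinity in `r = q⁻¹`; endpoint `r = 0` is one-cluster CPA for the pair
(`1{C_x ∈ 𝒰}`, `1{z ∈ C_x}`), endpoint `r = 1` is CPA for (`1{C_x ∈ 𝒰}`, `φ_{G − C̄_x}(z ↮ c)`) after the cluster Markov property.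
[cite: VandenbergHaggstromKahn2005, Thm. 1.3 (p. 6); Thm. 2.1 (p. 9); Lemma 2.3 (p. 10)] [cite: Grimmett2006, Thm. (3.1)(a) (p. 37); Thm. (3.21) (p. 43)] -/
theorem condClusterDomAdjOn_of_one_le {q : ℝ} (hq : 1 ≤ q) : CondClusterDomAdjOn V q := by
  intro w x z c 𝒰 h𝒰
  have hq0 : 0 < q := one_pos.trans_le hq
  have hr0 : 0 ≤ q⁻¹ := (inv_pos.2 hq0).le
  have hr1 : q⁻¹ ≤ 1 := inv_le_one_of_one_le₀ hq
  have hκ : 0 < rcPartitionFunctionW (Function.update w s(x, z) 0) q ∅ /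
      rcPartitionFunctionW (Function.update w s(x, z) 1) q ∅ :=
    div_pos (rcPartitionFunctionW_pos _ hq0 ∅) (rcPartitionFunctionW_pos _ hq0 ∅)
  rw [real_update_one_eq w hq0 x z, real_update_one_eq w hq0 x z, real_eq_rcE_ind _ hq0, real_eq_rcE_ind _ hq0]
  simp only [ind_clusterIn_sepEv_insert, ind_sepEv_insert]
  rw [rcE_toggle_ind, rcE_toggle_ind, glued_inter_openConn_eq, sepEv_inter_sepEv_inter_openConn_eq]
  -- names
  set u := Function.update w s(x, z) 0 with hu
  set κ := rcPartitionFunctionW u q ∅ / rcPartitionFunctionW (Function.update w s(x, z) 1) q ∅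
  set A : Set (BondConfig V) := clusterIn x 𝒰 with hA
  set N : Set (BondConfig V) := sepEv x c with hN
  set A' : Set (BondConfig V) := {ω | openCluster ω x ∪ openCluster ω z ∈ 𝒰} with hA'
  set an := rcE u q (ind (A ∩ N))
  set n := rcE u q (ind N)
  set a := rcE u q (ind (A ∩ N ∩ openConn x z))
  set a' := rcE u q (ind (A' ∩ (N ∩ sepEv z c) ∩ sepEv x z))
  set nd := rcE u q (ind (N ∩ openConn x z))
  set n'd := rcE u q (ind (N ∩ sepEv z c ∩ sepEv x z))
  -- (T0) endpoint r = 0: CPA for (1{C_x ∈ 𝒰}, 1{z ∈ C_x}) given x ↮ c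
  have T0 : an * nd ≤ n * a := by
    have key := cpa_rcE u hq x c (fun C => ind 𝒰 {a | a = x ∨ ∃ e ∈ C, a ∈ e})
      (fun C => ind {S : Set V | z ∈ S} {a | a = x ∨ ∃ e ∈ C, a ∈ e})
      (monotone_ind_span x h𝒰) (monotone_ind_span x (SoloBlindKN.isUpperSet_containing z))
    simp only [ind_span_openEdgeCluster, clusterIn_mem_eq_openConn, ind_mul_ind] at key
    have e1 : openConn x z ∩ N = N ∩ openConn x z := inter_comm _ _
    have e2 : A ∩ openConn x z ∩ N = A ∩ N ∩ openConn x z := by rw [inter_assoc, inter_comm (openConn x z), ← inter_assoc]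
    rw [e1, e2] at key
    exact key
  -- (F3) totals: a + a' = φ⁰(A' ∩ N') and nd + n'd = φ⁰(N')
  have F3a : rcE u q (ind (A' ∩ (N ∩ sepEv z c))) = a + a' := by
    rw [rcE_ind_split u q (A' ∩ (N ∩ sepEv z c)) x z, glued_inter_openConn_eq]
  have F3b : rcE u q (ind (N ∩ sepEv z c)) = nd + n'd := by
    rw [rcE_ind_split u q (N ∩ sepEv z c) x z, sepEv_inter_sepEv_inter_openConn_eq]
  -- (F4) dropping C_z: A ∩ N' ⊆ A' ∩ N'
  have F4 : rcE u q (ind (A ∩ (N ∩ sepEv z c))) ≤ rcE u q (ind (A' ∩ (N ∩ sepEv z c))) := by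
    refine rcE_mono_fun u hq0 fun ω => ?_
    by_cases hω : ω ∈ A ∩ (N ∩ sepEv z c)
    · have hω' : ω ∈ A' ∩ (N ∩ sepEv z c) := ⟨h𝒰 subset_union_left hω.1, hω.2⟩
      rw [ind_of_mem hω, ind_of_mem hω']
    · rw [ind_of_not_mem hω]; exact ind_nonneg _ _
  -- (F5) endpoint r = 1: CPA for (1{C_x ∈ 𝒰}, h(C_x)) with h(C) = φ_{G − B(C)}(c ↮ z), after Markov
  have F5 : an * rcE u q (ind (N ∩ sepEv z c)) ≤ n * rcE u q (ind (A ∩ (N ∩ sepEv z c))) := by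
    have mk1 := markov_rcE u hq0 x c (fun _ => (1 : ℝ)) {S : Set V | z ∉ S}
    have mkA := markov_rcE u hq0 x c (fun C => ind 𝒰 {a | a = x ∨ ∃ e ∈ C, a ∈ e}) {S : Set V | z ∉ S}
    have key := cpa_rcE u hq x c (fun C => ind 𝒰 {a | a = x ∨ ∃ e ∈ C, a ∈ e})
      (fun C => (rcMeasureW (delW u (barOf {x} C)) q ∅).real (sepEv c z))
      (monotone_ind_span x h𝒰) (monotone_real_sepEv_delW u hq x c z)
    simp only [ind_span_openEdgeCluster, clusterIn_not_mem_eq_sepEv, one_mul] at mk1 mkA key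
    rw [← mk1, ← mkA] at key
    simp only [ind_mul_ind] at key
    have e1 : sepEv c z ∩ N = N ∩ sepEv z c := by rw [inter_comm, sepEv_comm c z]
    have e2 : A ∩ sepEv c z ∩ N = A ∩ (N ∩ sepEv z c) := by rw [inter_assoc, sepEv_comm c z, inter_comm (sepEv z c)]
    rw [e1, e2] at key
    exact key
  -- assembly: T(r) = (1 - r)·T0 + r·T1 ≥ 0
  have hn : 0 ≤ n := rcE_nonneg_fun u hq0 fun ω => ind_nonneg _ _
  have key : an * (nd + q⁻¹ * n'd) ≤ (a + q⁻¹ * a') * n := by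
    have T1 : an * (nd + n'd) ≤ n * (a + a') := by
      rw [← F3a, ← F3b]
      exact F5.trans (mul_le_mul_of_nonneg_left F4 hn)
    have split : (a + q⁻¹ * a') * n - an * (nd + q⁻¹ * n'd) =
        (1 - q⁻¹) * (n * a - an * nd) + q⁻¹ * (n * (a + a') - an * (nd + n'd)) := by ring
    nlinarith [mul_nonneg (sub_nonneg.2 hr1) (sub_nonneg.2 T0), mul_nonneg hr0 (sub_nonneg.2 T1), split]
  calc an * (κ * (nd + q⁻¹ * n'd)) = κ * (an * (nd + q⁻¹ * n'd)) := by ring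
    _ ≤ κ * ((a + q⁻¹ * a') * n) := mul_le_mul_of_nonneg_left key hκ.le
    _ = κ * (a + q⁻¹ * a') * n := by ring

/-- `CondClusterDomAdjFK q` for every `q ≥ 1`. [cite: VandenbergHaggstromKahn2005, Thm. 1.3 (p. 6)] -/
theorem condClusterDomAdjFK_of_one_le {q : ℝ} (hq : 1 ≤ q) : CondClusterDomAdjFK q := fun _ => condClusterDomAdjOn_of_one_le hq

/-! ### MMc⁻ for every `q ≥ 1` -/

omit [Fintype V] in
/-- `1_{C_c ∈ 𝒱, x↮c}(ω ∪ {xz}) = 1_{C_c ∈ 𝒱, x↮c, z↮c}(ω)`: off the clusters of `x` and `z` the cluster of `c` is unchanged. [folklore] -/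
theorem ind_clusterIn_other_sepEv_insert (x z c : V) (𝒱 : Set (Set V)) (ω : BondConfig V) :
    ind (clusterIn c 𝒱 ∩ sepEv x c) (insert s(x, z) ω) = ind (clusterIn c 𝒱 ∩ (sepEv x c ∩ sepEv z c)) ω := by
  refine BystanderBHK.ind_congr ?_
  rw [mem_inter_iff, mem_inter_iff, insert_mem_sepEv_self_iff]
  constructor
  · rintro ⟨hB, hxc, hzc⟩
    refine ⟨?_, hxc, hzc⟩
    change openCluster (insert s(x, z) ω) c ∈ 𝒱 at hB
    change openCluster ω c ∈ 𝒱
    rwa [openCluster_insert_of_sep ω (fun h => hxc h.symm) (fun h => hzc h.symm)] at hB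
  · rintro ⟨hB, hxc, hzc⟩
    refine ⟨?_, hxc, hzc⟩
    change openCluster ω c ∈ 𝒱 at hB
    change openCluster (insert s(x, z) ω) c ∈ 𝒱
    rwa [openCluster_insert_of_sep ω (fun h => hxc h.symm) (fun h => hzc h.symm)]

/-- **MMc⁻ holds for every `q ≥ 1`**: given `{x ↮ c}`, the law of `C_c` under `φ_{w,q}` is stochastically decreasing in the state of a
pair `xz` at `x`.  Proof: contraction identity + affinity in `r = q⁻¹`; endpoint `r = 1` is one-cluster CPA for (`1{C_c ∈ 𝒱}`,
`1{z ∈ C_c}`), endpoint `r = 0` is the increasing/decreasing CPA for (`1{C_c ∈ 𝒱}`, `1{z ∉ C_c}·φ_{G − C̄_c}(x ↔ z)`) after the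
cluster Markov property.
[cite: VandenbergHaggstromKahn2005, Thm. 1.4 (p. 7); Thm. 2.1 (p. 9); Lemma 2.3 (p. 10)] [cite: Grimmett2006, Thm. (3.1)(a) (p. 37); Thm. (3.21) (p. 43)] -/
theorem crossClusterAntiAdjOn_of_one_le {q : ℝ} (hq : 1 ≤ q) : CrossClusterAntiAdjOn V q := by
  intro w x z c 𝒱 h𝒱
  have hq0 : 0 < q := one_pos.trans_le hq
  have hr0 : 0 ≤ q⁻¹ := (inv_pos.2 hq0).le
  have hr1 : q⁻¹ ≤ 1 := inv_le_one_of_one_le₀ hq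
  have hκ : 0 < rcPartitionFunctionW (Function.update w s(x, z) 0) q ∅ /
      rcPartitionFunctionW (Function.update w s(x, z) 1) q ∅ :=
    div_pos (rcPartitionFunctionW_pos _ hq0 ∅) (rcPartitionFunctionW_pos _ hq0 ∅)
  rw [real_update_one_eq w hq0 x z, real_update_one_eq w hq0 x z, real_eq_rcE_ind _ hq0, real_eq_rcE_ind _ hq0]
  simp only [ind_clusterIn_other_sepEv_insert, ind_sepEv_insert]
  rw [rcE_toggle_ind, rcE_toggle_ind]
  -- names
  set u := Function.update w s(x, z) 0 with hu
  set κ := rcPartitionFunctionW u q ∅ / rcPartitionFunctionW (Function.update w s(x, z) 1) q ∅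
  set B : Set (BondConfig V) := clusterIn c 𝒱 with hB
  set M : Set (BondConfig V) := sepEv x c with hM
  set bm := rcE u q (ind (B ∩ M))
  set m := rcE u q (ind M)
  set bm'c := rcE u q (ind (B ∩ (M ∩ sepEv z c) ∩ openConn x z))
  set bm'd := rcE u q (ind (B ∩ (M ∩ sepEv z c) ∩ sepEv x z))
  set m'c := rcE u q (ind (M ∩ sepEv z c ∩ openConn x z))
  set m'd := rcE u q (ind (M ∩ sepEv z c ∩ sepEv x z))
  -- (T'1) endpoint r = 1: CPA for (1{C_c ∈ 𝒱}, 1{z ∈ C_c}) given c ↮ x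
  have T1 : m * (bm'c + bm'd) ≤ bm * (m'c + m'd) := by
    have key := cpa_rcE u hq c x (fun C => ind 𝒱 {a | a = c ∨ ∃ e ∈ C, a ∈ e})
      (fun C => ind {S : Set V | z ∈ S} {a | a = c ∨ ∃ e ∈ C, a ∈ e})
      (monotone_ind_span c h𝒱) (monotone_ind_span c (SoloBlindKN.isUpperSet_containing z))
    simp only [ind_span_openEdgeCluster, clusterIn_mem_eq_openConn, ind_mul_ind, sepEv_comm c x] at key
    have e1 : openConn c z ∩ M = M ∩ openConn c z := inter_comm _ _
    have e2 : B ∩ openConn c z ∩ M = B ∩ M ∩ openConn c z := by rw [inter_assoc, inter_comm (openConn c z), ← inter_assoc]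
    rw [e1, e2] at key
    -- key : bm * φ(M, c↔z) ≤ m * φ(B, M, c↔z)
    have key' : bm * rcE u q (ind (M ∩ openConn c z)) ≤ m * rcE u q (ind (B ∩ M ∩ openConn c z)) := key
    have s1 : bm = rcE u q (ind (B ∩ M ∩ openConn c z)) + (bm'c + bm'd) := by
      rw [← rcE_ind_split, sepEv_comm z c, ← inter_assoc, ← rcE_ind_split]
    have s2 : m = rcE u q (ind (M ∩ openConn c z)) + (m'c + m'd) := by
      rw [← rcE_ind_split, sepEv_comm z c, ← rcE_ind_split]
    have h1 : bm'c + bm'd = bm - rcE u q (ind (B ∩ M ∩ openConn c z)) := by linarith [s1]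
    have h2 : m'c + m'd = m - rcE u q (ind (M ∩ openConn c z)) := by linarith [s2]
    have h3 : bm * (m'c + m'd) - m * (bm'c + bm'd) =
        m * rcE u q (ind (B ∩ M ∩ openConn c z)) - bm * rcE u q (ind (M ∩ openConn c z)) := by
      rw [h1, h2]; ring
    linarith [key', h3]
  -- (T'0) endpoint r = 0: CPA (increasing/decreasing) for (1{C_c ∈ 𝒱}, 1{z ∉ C_c}·φ_{G − B(C_c)}(x ↔ z)) after Markov
  have T0 : m * bm'c ≤ bm * m'c := by
    have mkB := markov_rcE u hq0 c x
      (fun C => ind 𝒱 {a | a = c ∨ ∃ e ∈ C, a ∈ e} * ind {S : Set V | z ∉ S} {a | a = c ∨ ∃ e ∈ C, a ∈ e}) {S : Set V | z ∈ S}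
    have mk0 := markov_rcE u hq0 c x (fun C => ind {S : Set V | z ∉ S} {a | a = c ∨ ∃ e ∈ C, a ∈ e}) {S : Set V | z ∈ S}
    have key := cpa_rcE_anti u hq c x (fun C => ind 𝒱 {a | a = c ∨ ∃ e ∈ C, a ∈ e})
      (fun C => ind {S : Set V | z ∉ S} {a | a = c ∨ ∃ e ∈ C, a ∈ e} *
        (rcMeasureW (delW u (barOf {c} C)) q ∅).real (openConn x z))
      (monotone_ind_span c h𝒱) ?_
    swap
    · intro C C' hCC'
      exact mul_le_mul (antitone_ind_span c (isLowerSet_not_containing z) hCC')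
        (antitone_real_openConn_delW u hq c x z hCC') measureReal_nonneg (ind_nonneg _ _)
    simp only [clusterIn_mem_eq_openConn] at mkB mk0
    have eB : rcE u q (fun ω => ind 𝒱 {a | a = c ∨ ∃ e ∈ openEdgeCluster ω c, a ∈ e} *
        (ind {S : Set V | z ∉ S} {a | a = c ∨ ∃ e ∈ openEdgeCluster ω c, a ∈ e} *
          (rcMeasureW (delW u (barOf {c} (openEdgeCluster ω c))) q ∅).real (openConn x z)) * ind (sepEv c x) ω) = bm'c := by
      rw [show (fun ω => ind 𝒱 {a | a = c ∨ ∃ e ∈ openEdgeCluster ω c, a ∈ e} *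
        (ind {S : Set V | z ∉ S} {a | a = c ∨ ∃ e ∈ openEdgeCluster ω c, a ∈ e} *
          (rcMeasureW (delW u (barOf {c} (openEdgeCluster ω c))) q ∅).real (openConn x z)) * ind (sepEv c x) ω) =
        (fun ω => ind 𝒱 {a | a = c ∨ ∃ e ∈ openEdgeCluster ω c, a ∈ e} *
          ind {S : Set V | z ∉ S} {a | a = c ∨ ∃ e ∈ openEdgeCluster ω c, a ∈ e} *
          (rcMeasureW (delW u (barOf {c} (openEdgeCluster ω c))) q ∅).real (openConn x z) * ind (sepEv c x) ω)
        from funext fun ω => by ring, ← mkB]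
      refine congrArg (rcE u q) (funext fun ω => ?_)
      simp only [ind_span_openEdgeCluster, clusterIn_not_mem_eq_sepEv, ind_mul_ind]
      refine BystanderBHK.ind_congr ?_
      simp only [mem_inter_iff, mem_sepEv_iff]
      constructor
      · rintro ⟨⟨⟨h1, h2⟩, h3⟩, h4⟩; exact ⟨⟨h1, fun h => h4 h.symm, fun h => h2 h.symm⟩, h3⟩
      · rintro ⟨⟨h1, h4, h2⟩, h3⟩; exact ⟨⟨⟨h1, fun h => h2 h.symm⟩, h3⟩, fun h => h4 h.symm⟩
    have e0 : rcE u q (fun ω => ind {S : Set V | z ∉ S} {a | a = c ∨ ∃ e ∈ openEdgeCluster ω c, a ∈ e} *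
        (rcMeasureW (delW u (barOf {c} (openEdgeCluster ω c))) q ∅).real (openConn x z) * ind (sepEv c x) ω) = m'c := by
      rw [← mk0]
      refine congrArg (rcE u q) (funext fun ω => ?_)
      simp only [ind_span_openEdgeCluster, clusterIn_not_mem_eq_sepEv, ind_mul_ind]
      refine BystanderBHK.ind_congr ?_
      simp only [mem_inter_iff, mem_sepEv_iff]
      constructor
      · rintro ⟨⟨h2, h3⟩, h4⟩; exact ⟨⟨fun h => h4 h.symm, fun h => h2 h.symm⟩, h3⟩
      · rintro ⟨⟨h4, h2⟩, h3⟩; exact ⟨⟨fun h => h2 h.symm, h3⟩, fun h => h4 h.symm⟩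
    have em : rcE u q (ind (sepEv c x)) = m := by rw [sepEv_comm c x]
    have ebm : rcE u q (fun ω => ind 𝒱 {a | a = c ∨ ∃ e ∈ openEdgeCluster ω c, a ∈ e} * ind (sepEv c x) ω) = bm := by
      refine congrArg (rcE u q) (funext fun ω => ?_)
      rw [ind_span_openEdgeCluster, ind_mul_ind, sepEv_comm c x]
    rw [eB, e0, em, ebm] at key
    exact key
  -- assembly
  have key : (bm'c + q⁻¹ * bm'd) * m ≤ bm * (m'c + q⁻¹ * m'd) := by
    have split : bm * (m'c + q⁻¹ * m'd) - (bm'c + q⁻¹ * bm'd) * m =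
        (1 - q⁻¹) * (bm * m'c - m * bm'c) + q⁻¹ * (bm * (m'c + m'd) - m * (bm'c + bm'd)) := by ring
    nlinarith [mul_nonneg (sub_nonneg.2 hr1) (sub_nonneg.2 T0), mul_nonneg hr0 (sub_nonneg.2 T1), split]
  calc κ * (bm'c + q⁻¹ * bm'd) * m = κ * ((bm'c + q⁻¹ * bm'd) * m) := by ring
    _ ≤ κ * (bm * (m'c + q⁻¹ * m'd)) := mul_le_mul_of_nonneg_left key hκ.le
    _ = bm * (κ * (m'c + q⁻¹ * m'd)) := by ring

/-- `CrossClusterAntiAdjFK q` for every `q ≥ 1`. [cite: VandenbergHaggstromKahn2005, Thm. 1.4 (p. 7)] -/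
theorem crossClusterAntiAdjFK_of_one_le {q : ℝ} (hq : 1 ≤ q) : CrossClusterAntiAdjFK q :=
  fun _ => crossClusterAntiAdjOn_of_one_le hq

/-! ### Regression: vdBHK Thm 1.3 / 1.4-shape statements for `φ_{w,q}`, `q ≥ 1`, THROUGH the two single-edge monotonicities -/

/-- For `q ≥ 1`, the conditioned hub inequality for `φ_{w,q}` via MMc⁺ and g8's conditioned Harris induction.
[cite: VandenbergHaggstromKahn2005, Thm. 1.3 (p. 6)] -/
example {q : ℝ} (hq : 1 ≤ q) (w : Sym2 V → unitInterval) (o a b c : V) : HubCondUnder (rcMeasureW w q ∅) o a b c :=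
  hubCondUnder_of_condClusterDomAdjOn (one_pos.trans_le hq) (condClusterDomAdjOn_of_one_le hq) w o a b c

/-- For `q ≥ 1`, the two-arm negative correlation for `φ_{w,q}` via MMc⁺ ∧ MMc⁻ and g8's conditioned Harris induction.
[cite: VandenbergHaggstromKahn2005, Thm. 1.4 (p. 7)] -/
example {q : ℝ} (hq : 1 ≤ q) (w : Sym2 V → unitInterval) (o a b c : V) : TwoArmNegUnder (rcMeasureW w q ∅) o a b c :=
  twoArmNegUnder_of_cond (one_pos.trans_le hq) (condClusterDomAdjOn_of_one_le hq) (crossClusterAntiAdjOn_of_one_le hq) w o a b c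

/-- For `q ≥ 1`, `TwoArmNegFK q` through the conditional nodes (the tree's `twoArmNegFK_of_one_le` proves it directly from vdBHK 2.1).
[cite: VandenbergHaggstromKahn2005, Thm. 1.4 (p. 7)] -/
example {q : ℝ} (hq : 1 ≤ q) : TwoArmNegFK q :=
  twoArmNegFK_of_cond (one_pos.trans_le hq) (condClusterDomAdjFK_of_one_le hq) (crossClusterAntiAdjFK_of_one_le hq)

end FK

end Summit.CriticalPhenomena.PercolationContinuityZ3.Theorems

end
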